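import Summits.CriticalPhenomena.PercolationContinuityZ3.Theorems.PercNearOneGluingNoHeavyLowerTailSetPortMerge
import HarnessLib

/-!
# `NoHeavyLowerTail` (stmt-CriticalPhenomena-4575) — the set averaged-port inequalities SET-AP1 / SAP1c / AP* as typed
# sufficient conditions for set-champion stability of a relay-neighboured Steiner SET

Support file (prover `prim-hp-6`, hull-port cell, observer-set / OES technique; `--supports stmt-CriticalPhenomena-4575`).
No definitions, no named facts, no sorries.

Notation (`μ = prodBernoulli w` on `Fin n`, relays `A`, level `j`): `U` disjoint from `A` with ports `p 0, …, p (d−1) ∈ A`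
(every positive pair from `U` to its outside ends at some `p l`); `π(U) = {z ∈ A : z ↔ some x ∈ U}` (set semantics, members
NOT glued), `bad(U) = μ{1 ≤ |π(U)| ≤ j}`, `I(v) = μ{|π(v)| ≤ j}`; the set first-open-port events
`F_l = {some pair x–p l (x ∈ U) open, every pair x–p m (x ∈ U, m < l) closed}`; `c ↮ U` = "`c` joined to no member".
For an enumeration `p` write `E(p) := Σ_l μ(F_l)·I(p l)`; for the ports sorted by decreasing `I` this is
`E[max over open ports of I; some port open]` (prim-lf-3, LF3-APSTAR.md).  Three inequalities (crux evidence HP6-MEMO3-SETAP1.md;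
0 violations in ≈ 4·10⁴ exact instances, n ≤ 8, for the sorted / reverse-greedy enumerations):
* SET-AP1(p):  `Σ_l μ(F_l ∩ {p l light}) ≤ E(p)`  — c-free ("the first open port is on average less light than unconditionally");
  for `|U| = 1` it is prim-lf-3's theorem `AveragedPort.bad_le_firstOpenSum`;
* SAP1c(p, c): `μ(c ↔ U, c light) + Σ_l μ(c ↮ U, F_l, p l light) ≤ E(p)`  — the designated-port form;
* AP*(p, c):   `μ(c ↮ U, 1 ≤ |π(U)| ≤ j) + μ(c ↔ U, c light) ≤ E(p)`  — prim-lf-3's (AP*) `bad_{H/U} + loss(c) ≤ Emax` written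
  without gluing.
This file records the elementary implications, sorry-free:
* `SetPort.bad_le_of_setAP1` — SET-AP1(p) ⟹ `bad(U) ≤ E(p)` (prim-lf-3's c-free core (APz)): on `{1 ≤ |π(U)| ≤ j}` some port is
  open and the first open port `p l` is light, because `π(p l) ⊆ π(U)`.
* `SetPort.apStar_of_sap1c` — SAP1c(p, c) ⟹ AP*(p, c), by the same inclusion intersected with `{c ↮ U}`.
* `SetPort.setCS_of_apStar` — AP*(p, c) and `I(p l) ≤ I(c)` for every port ⟹ `CS_w(U, c)`:
  `μ(c ↮ U, 1 ≤ |π(U)| ≤ j) ≤ μ(c ↮ U, |π(c)| ≤ j)` (because `Σ_l μ(F_l) ≤ 1`); `SetPort.setCS_of_sap1c` is the composite.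
So SAP1c (or AP*) for the light relay-neighboured stars of an observer, with `c` the champion of `G − o`, is exactly the `hCS`
input of `Theorems.cil_of_setGap_deleted` for those stars.  These are CONDITIONAL reductions: SET-AP1 / SAP1c / AP* are
census-clean conjectures whose `|U| = 1` cases are theorems, not theorems themselves.
-/

noncomputable section

namespace Summit.CriticalPhenomena.PercolationContinuityZ3.Theorems

open MeasureTheory Set Literature.Probability.LatticeModels Literature.Probability.Percolation
open scoped Classical BigOperators

variable {n : ℕ}

namespace SetPort

/-! ### The set first-open-port events -/

/-- The set first-open-port events are pairwise disjoint, so `Σ_l μ(F_l) ≤ 1`. [folklore] -/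
theorem sum_real_setFirstOpen_le_one (w : Sym2 (Fin n) → unitInterval) (U : Finset (Fin n)) {d : ℕ}
    (p : Fin d → Fin n) :
    ∑ l : Fin d, (prodBernoulli w).real {ω : BondConfig (Fin n) |
        (∃ x ∈ U, s(x, p l) ∈ ω) ∧ ∀ m, m < l → ∀ x ∈ U, s(x, p m) ∉ ω} ≤ 1 := by
  haveI : IsProbabilityMeasure (prodBernoulli w) := inferInstance
  set F : Fin d → Set (BondConfig (Fin n)) := fun l =>
    {ω | (∃ x ∈ U, s(x, p l) ∈ ω) ∧ ∀ m, m < l → ∀ x ∈ U, s(x, p m) ∉ ω} with hF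
  have hdisj : (↑(Finset.univ : Finset (Fin d)) : Set (Fin d)).PairwiseDisjoint F := by
    intro l _ l' _ hne
    rw [Function.onFun, Set.disjoint_left]
    rintro ω ⟨⟨x, hx, h1⟩, h2⟩ ⟨⟨x', hx', h1'⟩, h2'⟩
    rcases lt_trichotomy l l' with h | h | h
    · exact h2' l h x hx h1
    · exact hne h
    · exact h2 l' h x' hx' h1'
  calc ∑ l : Fin d, (prodBernoulli w).real (F l)
      = (prodBernoulli w).real (⋃ l ∈ (Finset.univ : Finset (Fin d)), F l) :=
        (measureReal_biUnion_finset hdisj fun l _ => MeasurableSet.of_discrete).symm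
    _ ≤ 1 := measureReal_le_one

/-- On the support event: if `U` (disjoint from `A`; every positive outside pair ends at an enumerated port `p l ∈ A`) reaches
between `1` and `j` relays, then some port carries an open pair from `U`, and the FIRST such port `p l` is light
(`π(p l) ⊆ π(U)`). [folklore] -/
theorem exists_firstOpen_light (w : Sym2 (Fin n) → unitInterval) (A U : Finset (Fin n)) (hUA : Disjoint U A) (j : ℕ)
    {d : ℕ} (p : Fin d → Fin n) (hpA : ∀ l, p l ∈ A)
    (hobs : ∀ x ∈ U, ∀ v : Fin n, v ∉ U → w s(x, v) ≠ 0 → ∃ l, v = p l)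
    {ω : BondConfig (Fin n)} (hω : ∀ e ∈ ω, w e ≠ 0)
    (h1 : 1 ≤ (A.filter fun z => ∃ x ∈ U, ω ∈ openConn x z).card)
    (hj : (A.filter fun z => ∃ x ∈ U, ω ∈ openConn x z).card ≤ j) :
    ∃ l : Fin d, ((∃ x ∈ U, s(x, p l) ∈ ω) ∧ ∀ m, m < l → ∀ x ∈ U, s(x, p m) ∉ ω) ∧
      (A.filter fun z => ω ∈ openConn (p l) z).card ≤ j := by
  -- some port carries an open pair
  obtain ⟨z, hz⟩ := Finset.card_pos.1 (by omega : 0 < (A.filter fun z => ∃ x ∈ U, ω ∈ openConn x z).card)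
  rw [Finset.mem_filter] at hz
  obtain ⟨hzA, x, hx, hxz⟩ := hz
  have hzU : z ∉ U := fun h => Finset.disjoint_left.1 hUA h hzA
  obtain ⟨x', hx', v, hv, hxv, -⟩ := exists_exit_of_reachable U hx hzU hxz
  obtain ⟨l₀, rfl⟩ := hobs x' hx' v hv (hω _ hxv)
  -- the first such port
  set S := Finset.univ.filter (fun l : Fin d => ∃ x ∈ U, s(x, p l) ∈ ω) with hS
  have hSne : S.Nonempty := ⟨l₀, Finset.mem_filter.2 ⟨Finset.mem_univ _, x', hx', hxv⟩⟩
  have hlS : S.min' hSne ∈ S := Finset.min'_mem S hSne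
  obtain ⟨y, hy, hyl⟩ := (Finset.mem_filter.1 hlS).2
  refine ⟨S.min' hSne, ⟨⟨y, hy, hyl⟩, fun m hm x'' hx'' hopen => ?_⟩, ?_⟩
  · exact absurd hm (not_lt.2 (Finset.min'_le S m (Finset.mem_filter.2 ⟨Finset.mem_univ _, x'', hx'', hopen⟩)))
  · have hplU : p (S.min' hSne) ∉ U := fun h => Finset.disjoint_left.1 hUA h (hpA _)
    have hyp : (openGraph ω).Reachable y (p (S.min' hSne)) :=
      SimpleGraph.Adj.reachable ((openGraph_adj ω y (p (S.min' hSne))).2 ⟨hyl, fun h => hplU (h ▸ hy)⟩)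
    refine le_trans (Finset.card_le_card fun z' hz' => ?_) hj
    rw [Finset.mem_filter] at hz' ⊢
    exact ⟨hz'.1, y, hy, hyp.trans hz'.2⟩

/-! ### SET-AP1 ⟹ the c-free core (APz) -/

/-- **SET-AP1 gives the c-free averaged port bound (APz).**  If `Σ_l μ(F_l ∩ {p l light}) ≤ Σ_l μ(F_l)·I(p l)` (SET-AP1 for the
enumeration `p`), then `bad(U) = μ{1 ≤ |π(U)| ≤ j} ≤ Σ_l μ(F_l)·I(p l)`. [this file] -/
theorem bad_le_of_setAP1 (w : Sym2 (Fin n) → unitInterval) (A U : Finset (Fin n)) (hUA : Disjoint U A) (j : ℕ)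
    {d : ℕ} (p : Fin d → Fin n) (hpA : ∀ l, p l ∈ A)
    (hobs : ∀ x ∈ U, ∀ v : Fin n, v ∉ U → w s(x, v) ≠ 0 → ∃ l, v = p l)
    (hSAP : ∑ l : Fin d, (prodBernoulli w).real {ω : BondConfig (Fin n) |
          ((∃ x ∈ U, s(x, p l) ∈ ω) ∧ ∀ m, m < l → ∀ x ∈ U, s(x, p m) ∉ ω) ∧
          (A.filter fun z => ω ∈ openConn (p l) z).card ≤ j} ≤
      ∑ l : Fin d, (prodBernoulli w).real {ω : BondConfig (Fin n) |
          (∃ x ∈ U, s(x, p l) ∈ ω) ∧ ∀ m, m < l → ∀ x ∈ U, s(x, p m) ∉ ω} *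
        (prodBernoulli w).real {ω : BondConfig (Fin n) | (A.filter fun z => ω ∈ openConn (p l) z).card ≤ j}) :
    (prodBernoulli w).real {ω : BondConfig (Fin n) |
        1 ≤ (A.filter fun z => ∃ x ∈ U, ω ∈ openConn x z).card ∧
        (A.filter fun z => ∃ x ∈ U, ω ∈ openConn x z).card ≤ j} ≤
      ∑ l : Fin d, (prodBernoulli w).real {ω : BondConfig (Fin n) |
          (∃ x ∈ U, s(x, p l) ∈ ω) ∧ ∀ m, m < l → ∀ x ∈ U, s(x, p m) ∉ ω} *
        (prodBernoulli w).real {ω : BondConfig (Fin n) | (A.filter fun z => ω ∈ openConn (p l) z).card ≤ j} := by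
  refine le_trans ?_ hSAP
  set G : Fin d → Set (BondConfig (Fin n)) := fun l => {ω : BondConfig (Fin n) |
    ((∃ x ∈ U, s(x, p l) ∈ ω) ∧ ∀ m, m < l → ∀ x ∈ U, s(x, p m) ∉ ω) ∧
    (A.filter fun z => ω ∈ openConn (p l) z).card ≤ j} with hG
  rw [← CutObserver.measureReal_inter_support w {ω : BondConfig (Fin n) |
        1 ≤ (A.filter fun z => ∃ x ∈ U, ω ∈ openConn x z).card ∧
        (A.filter fun z => ∃ x ∈ U, ω ∈ openConn x z).card ≤ j}]
  calc (prodBernoulli w).real ({ω : BondConfig (Fin n) |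
          1 ≤ (A.filter fun z => ∃ x ∈ U, ω ∈ openConn x z).card ∧
          (A.filter fun z => ∃ x ∈ U, ω ∈ openConn x z).card ≤ j} ∩ {ω | ∀ e ∈ ω, w e ≠ 0})
      ≤ (prodBernoulli w).real (⋃ l : Fin d, G l) := by
        refine measureReal_mono (fun ω hω => ?_) (measure_ne_top _ _)
        obtain ⟨⟨h1, hj⟩, hω⟩ := hω
        obtain ⟨l, hl⟩ := exists_firstOpen_light w A U hUA j p hpA hobs hω h1 hj
        exact mem_iUnion.2 ⟨l, hl⟩
    _ ≤ ∑ l : Fin d, (prodBernoulli w).real (G l) := measureReal_iUnion_fintype_le _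

/-! ### SAP1c ⟹ AP* -/

/-- **The designated-port inequality SAP1c gives prim-lf-3's AP*.**  If
`μ(c ↔ U, c light) + Σ_l μ(c ↮ U, F_l, p l light) ≤ Σ_l μ(F_l)·I(p l)`, then
`μ(c ↮ U, 1 ≤ |π(U)| ≤ j) + μ(c ↔ U, c light) ≤ Σ_l μ(F_l)·I(p l)`. [this file] -/
theorem apStar_of_sap1c (w : Sym2 (Fin n) → unitInterval) (A U : Finset (Fin n)) (hUA : Disjoint U A) (c : Fin n)
    (j : ℕ) {d : ℕ} (p : Fin d → Fin n) (hpA : ∀ l, p l ∈ A)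
    (hobs : ∀ x ∈ U, ∀ v : Fin n, v ∉ U → w s(x, v) ≠ 0 → ∃ l, v = p l)
    (hSAP : (prodBernoulli w).real {ω : BondConfig (Fin n) | (∃ x ∈ U, ω ∈ openConn c x) ∧
          (A.filter fun z => ω ∈ openConn c z).card ≤ j} +
        ∑ l : Fin d, (prodBernoulli w).real {ω : BondConfig (Fin n) | (∀ x ∈ U, ω ∉ openConn c x) ∧
          ((∃ x ∈ U, s(x, p l) ∈ ω) ∧ ∀ m, m < l → ∀ x ∈ U, s(x, p m) ∉ ω) ∧
          (A.filter fun z => ω ∈ openConn (p l) z).card ≤ j} ≤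
      ∑ l : Fin d, (prodBernoulli w).real {ω : BondConfig (Fin n) |
          (∃ x ∈ U, s(x, p l) ∈ ω) ∧ ∀ m, m < l → ∀ x ∈ U, s(x, p m) ∉ ω} *
        (prodBernoulli w).real {ω : BondConfig (Fin n) | (A.filter fun z => ω ∈ openConn (p l) z).card ≤ j}) :
    (prodBernoulli w).real {ω : BondConfig (Fin n) | (∀ x ∈ U, ω ∉ openConn c x) ∧
        1 ≤ (A.filter fun z => ∃ x ∈ U, ω ∈ openConn x z).card ∧
        (A.filter fun z => ∃ x ∈ U, ω ∈ openConn x z).card ≤ j} +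
      (prodBernoulli w).real {ω : BondConfig (Fin n) | (∃ x ∈ U, ω ∈ openConn c x) ∧
        (A.filter fun z => ω ∈ openConn c z).card ≤ j} ≤
      ∑ l : Fin d, (prodBernoulli w).real {ω : BondConfig (Fin n) |
          (∃ x ∈ U, s(x, p l) ∈ ω) ∧ ∀ m, m < l → ∀ x ∈ U, s(x, p m) ∉ ω} *
        (prodBernoulli w).real {ω : BondConfig (Fin n) | (A.filter fun z => ω ∈ openConn (p l) z).card ≤ j} := by
  refine le_trans ?_ hSAP
  rw [add_comm]
  refine add_le_add le_rfl ?_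
  set G : Fin d → Set (BondConfig (Fin n)) := fun l => {ω : BondConfig (Fin n) | (∀ x ∈ U, ω ∉ openConn c x) ∧
    ((∃ x ∈ U, s(x, p l) ∈ ω) ∧ ∀ m, m < l → ∀ x ∈ U, s(x, p m) ∉ ω) ∧
    (A.filter fun z => ω ∈ openConn (p l) z).card ≤ j} with hG
  rw [← CutObserver.measureReal_inter_support w {ω : BondConfig (Fin n) | (∀ x ∈ U, ω ∉ openConn c x) ∧
        1 ≤ (A.filter fun z => ∃ x ∈ U, ω ∈ openConn x z).card ∧
        (A.filter fun z => ∃ x ∈ U, ω ∈ openConn x z).card ≤ j}]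
  calc (prodBernoulli w).real ({ω : BondConfig (Fin n) | (∀ x ∈ U, ω ∉ openConn c x) ∧
          1 ≤ (A.filter fun z => ∃ x ∈ U, ω ∈ openConn x z).card ∧
          (A.filter fun z => ∃ x ∈ U, ω ∈ openConn x z).card ≤ j} ∩ {ω | ∀ e ∈ ω, w e ≠ 0})
      ≤ (prodBernoulli w).real (⋃ l : Fin d, G l) := by
        refine measureReal_mono (fun ω hω => ?_) (measure_ne_top _ _)
        obtain ⟨⟨hc, h1, hj⟩, hω⟩ := hω
        obtain ⟨l, hl⟩ := exists_firstOpen_light w A U hUA j p hpA hobs hω h1 hj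
        exact mem_iUnion.2 ⟨l, hc, hl⟩
    _ ≤ ∑ l : Fin d, (prodBernoulli w).real (G l) := measureReal_iUnion_fintype_le _

/-! ### AP* ⟹ set-champion stability for a dominating witness -/

/-- **AP* with a port-dominating witness gives `CS_w(U, c)`.**  If
`μ(c ↮ U, 1 ≤ |π(U)| ≤ j) + μ(c ↔ U, c light) ≤ Σ_l μ(F_l)·I(p l)` (AP*) and `I(p l) ≤ I(c)` for every port, then
`μ(c ↮ U, 1 ≤ |π(U)| ≤ j) ≤ μ(c ↮ U, |π(c)| ≤ j)`.  (`Σ_l μ(F_l) ≤ 1` and `I(c) = μ(c ↮ U, c light) + μ(c ↔ U, c light)`.)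
[this file] -/
theorem setCS_of_apStar (w : Sym2 (Fin n) → unitInterval) (A U : Finset (Fin n)) (c : Fin n) (j : ℕ) {d : ℕ}
    (p : Fin d → Fin n)
    (hAP : (prodBernoulli w).real {ω : BondConfig (Fin n) | (∀ x ∈ U, ω ∉ openConn c x) ∧
          1 ≤ (A.filter fun z => ∃ x ∈ U, ω ∈ openConn x z).card ∧
          (A.filter fun z => ∃ x ∈ U, ω ∈ openConn x z).card ≤ j} +
        (prodBernoulli w).real {ω : BondConfig (Fin n) | (∃ x ∈ U, ω ∈ openConn c x) ∧
          (A.filter fun z => ω ∈ openConn c z).card ≤ j} ≤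
      ∑ l : Fin d, (prodBernoulli w).real {ω : BondConfig (Fin n) |
          (∃ x ∈ U, s(x, p l) ∈ ω) ∧ ∀ m, m < l → ∀ x ∈ U, s(x, p m) ∉ ω} *
        (prodBernoulli w).real {ω : BondConfig (Fin n) | (A.filter fun z => ω ∈ openConn (p l) z).card ≤ j})
    (hdom : ∀ l : Fin d,
      (prodBernoulli w).real {ω : BondConfig (Fin n) | (A.filter fun z => ω ∈ openConn (p l) z).card ≤ j} ≤
        (prodBernoulli w).real {ω : BondConfig (Fin n) | (A.filter fun z => ω ∈ openConn c z).card ≤ j}) :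
    (prodBernoulli w).real {ω : BondConfig (Fin n) | (∀ x ∈ U, ω ∉ openConn c x) ∧
        1 ≤ (A.filter fun z => ∃ x ∈ U, ω ∈ openConn x z).card ∧
        (A.filter fun z => ∃ x ∈ U, ω ∈ openConn x z).card ≤ j} ≤
      (prodBernoulli w).real {ω : BondConfig (Fin n) | (∀ x ∈ U, ω ∉ openConn c x) ∧
        (A.filter fun z => ω ∈ openConn c z).card ≤ j} := by
  set Ic := (prodBernoulli w).real {ω : BondConfig (Fin n) | (A.filter fun z => ω ∈ openConn c z).card ≤ j} with hIc
  -- `I(c)` splits along `{c ↮ U}`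
  have hsplit : Ic = (prodBernoulli w).real {ω : BondConfig (Fin n) | (∀ x ∈ U, ω ∉ openConn c x) ∧
        (A.filter fun z => ω ∈ openConn c z).card ≤ j} +
      (prodBernoulli w).real {ω : BondConfig (Fin n) | (∃ x ∈ U, ω ∈ openConn c x) ∧
        (A.filter fun z => ω ∈ openConn c z).card ≤ j} := by
    have e1 : {ω : BondConfig (Fin n) | (∀ x ∈ U, ω ∉ openConn c x) ∧
        (A.filter fun z => ω ∈ openConn c z).card ≤ j} =
        {ω : BondConfig (Fin n) | (A.filter fun z => ω ∈ openConn c z).card ≤ j} ∩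
          {ω | ∀ x ∈ U, ω ∉ openConn c x} := by
      ext ω; simp only [mem_setOf_eq, mem_inter_iff]; tauto
    have e2 : {ω : BondConfig (Fin n) | (∃ x ∈ U, ω ∈ openConn c x) ∧
        (A.filter fun z => ω ∈ openConn c z).card ≤ j} =
        {ω : BondConfig (Fin n) | (A.filter fun z => ω ∈ openConn c z).card ≤ j} \
          {ω | ∀ x ∈ U, ω ∉ openConn c x} := by
      ext ω; simp only [mem_setOf_eq, mem_sdiff, not_forall, not_not, exists_prop]; tauto
    rw [e1, e2, measureReal_inter_add_sdiff (MeasurableSet.of_discrete)]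
  -- the averaged sum is at most `I(c)`
  have hsum : ∑ l : Fin d, (prodBernoulli w).real {ω : BondConfig (Fin n) |
          (∃ x ∈ U, s(x, p l) ∈ ω) ∧ ∀ m, m < l → ∀ x ∈ U, s(x, p m) ∉ ω} *
        (prodBernoulli w).real {ω : BondConfig (Fin n) | (A.filter fun z => ω ∈ openConn (p l) z).card ≤ j} ≤ Ic := by
    calc ∑ l : Fin d, (prodBernoulli w).real {ω : BondConfig (Fin n) |
            (∃ x ∈ U, s(x, p l) ∈ ω) ∧ ∀ m, m < l → ∀ x ∈ U, s(x, p m) ∉ ω} *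
          (prodBernoulli w).real {ω : BondConfig (Fin n) | (A.filter fun z => ω ∈ openConn (p l) z).card ≤ j}
        ≤ ∑ l : Fin d, (prodBernoulli w).real {ω : BondConfig (Fin n) |
            (∃ x ∈ U, s(x, p l) ∈ ω) ∧ ∀ m, m < l → ∀ x ∈ U, s(x, p m) ∉ ω} * Ic :=
          Finset.sum_le_sum fun l _ => mul_le_mul_of_nonneg_left (hdom l) measureReal_nonneg
      _ = (∑ l : Fin d, (prodBernoulli w).real {ω : BondConfig (Fin n) |
            (∃ x ∈ U, s(x, p l) ∈ ω) ∧ ∀ m, m < l → ∀ x ∈ U, s(x, p m) ∉ ω}) * Ic := by rw [Finset.sum_mul]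
      _ ≤ 1 * Ic := mul_le_mul_of_nonneg_right (sum_real_setFirstOpen_le_one w U p) measureReal_nonneg
      _ = Ic := one_mul _
  have key := hAP.trans hsum
  rw [hsplit] at key
  linarith

/-- **SAP1c with a port-dominating witness gives `CS_w(U, c)`** (`apStar_of_sap1c` + `setCS_of_apStar`).  In particular, with
`c` a champion of `G − o` this is the `hCS` input of `Theorems.cil_of_setGap_deleted` for a light relay-neighboured star `U`
of the observer `o`. [this file] -/
theorem setCS_of_sap1c (w : Sym2 (Fin n) → unitInterval) (A U : Finset (Fin n)) (hUA : Disjoint U A) (c : Fin n)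
    (j : ℕ) {d : ℕ} (p : Fin d → Fin n) (hpA : ∀ l, p l ∈ A)
    (hobs : ∀ x ∈ U, ∀ v : Fin n, v ∉ U → w s(x, v) ≠ 0 → ∃ l, v = p l)
    (hSAP : (prodBernoulli w).real {ω : BondConfig (Fin n) | (∃ x ∈ U, ω ∈ openConn c x) ∧
          (A.filter fun z => ω ∈ openConn c z).card ≤ j} +
        ∑ l : Fin d, (prodBernoulli w).real {ω : BondConfig (Fin n) | (∀ x ∈ U, ω ∉ openConn c x) ∧
          ((∃ x ∈ U, s(x, p l) ∈ ω) ∧ ∀ m, m < l → ∀ x ∈ U, s(x, p m) ∉ ω) ∧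
          (A.filter fun z => ω ∈ openConn (p l) z).card ≤ j} ≤
      ∑ l : Fin d, (prodBernoulli w).real {ω : BondConfig (Fin n) |
          (∃ x ∈ U, s(x, p l) ∈ ω) ∧ ∀ m, m < l → ∀ x ∈ U, s(x, p m) ∉ ω} *
        (prodBernoulli w).real {ω : BondConfig (Fin n) | (A.filter fun z => ω ∈ openConn (p l) z).card ≤ j})
    (hdom : ∀ l : Fin d,
      (prodBernoulli w).real {ω : BondConfig (Fin n) | (A.filter fun z => ω ∈ openConn (p l) z).card ≤ j} ≤
        (prodBernoulli w).real {ω : BondConfig (Fin n) | (A.filter fun z => ω ∈ openConn c z).card ≤ j}) :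
    (prodBernoulli w).real {ω : BondConfig (Fin n) | (∀ x ∈ U, ω ∉ openConn c x) ∧
        1 ≤ (A.filter fun z => ∃ x ∈ U, ω ∈ openConn x z).card ∧
        (A.filter fun z => ∃ x ∈ U, ω ∈ openConn x z).card ≤ j} ≤
      (prodBernoulli w).real {ω : BondConfig (Fin n) | (∀ x ∈ U, ω ∉ openConn c x) ∧
        (A.filter fun z => ω ∈ openConn c z).card ≤ j} :=
  setCS_of_apStar w A U c j p (apStar_of_sap1c w A U hUA c j p hpA hobs hSAP) hdom

end SetPort

end Summit.CriticalPhenomena.PercolationContinuityZ3.Theorems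

end
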